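import Summits.RiemannHypothesis.RiemannHypothesis.Theorems.WeilFormatCOscTailAbelReal
import Summits.RiemannHypothesis.RiemannHypothesis.Theorems.WeilFormatCPolyWindowEntryBox
import HarnessLib

/-!
# Format C, design C∞ (E2c, data side): per-mode boxes of the trigonometric tags `C_m = Σ_j w_j cos(mφ_j)`, `S_m = Σ_j w_j sin(mφ_j)`

Route context: Fourier–Galerkin / Schur-complement certificates of Weil positivity on a window ("format C", C∞ door;
cell memo `run/shared/lean/pub/rh-explicit/rh-explicit-weil-2/gen15/E2-PLAN-v2.md` §6.4 (1); supporting stmt-RiemannHypothesis-0098;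
seat rh-explicit-weil-2).  The exact-range evaluator `CinfCoeff.rangeEntryBox` (`WeilFormatCCinfGramRange`) consumes one box per
mode of each tag.  For the trigonometric tags of the C∞ door (`−C_m`, `S_m`: finite prime sums `Σ_j w_j {cos,sin}(m φ_j)`,
`w_j = Λ(n_j)/√n_j`, `φ_j = π log n_j/a`) this file evaluates them per mode by BINARY POWERING of a phase box
`Z_j ∋ e^{iφ_j}` (depth `log₂ m`; a plain rotation recurrence `z^{m+1} = z^m·z` is NOT usable in endpoint interval
arithmetic — the wrapping effect inflates the width by `≈ √2` per step):

* `CinfCoeff.zpow S Z m ∋ z^m` (`zpowAux` with structural fuel, kernel-reducible; `mem_zpow`);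
* `CinfCoeff.trigTagC / trigTagS S Ws Zs m ∋ Σ_j w_j cos(mφ_j)` / `Σ_j w_j sin(mφ_j)` (`mem_trigTagC`, `mem_trigTagS`);
* the two smooth tags for the same consumer: `CinfCoeff.logTag S K m ∋ log m` under the decidable guard `logTagsOK`
  (`mem_logTag`), and the constant tag `1` is `WinConst.ratBox S 1` (`WinConst.mem_ratBox`).

The generator validates literal per-mode tables against these evaluators and feeds the tables to `rangeEntryBox`.
Interval plumbing only; standard axioms; no RH claim.
-/

set_option autoImplicit false
-- `Summit.RiemannHypothesis.RiemannHypothesis.…` is the layout-mandated namespace (summit = problem name).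
set_option linter.dupNamespace false

open Complex

namespace Summit.RiemannHypothesis.RiemannHypothesis.Theorems.WeilFormatC

open Literature.Analysis.ValidatedNumerics Literature.Analysis.ValidatedNumerics.NumericsMP

namespace CinfCoeff

open WinEntry (sumBox mem_sumBox)

variable {S : ℕ}

/-! ## Binary powering of a complex box -/

/-- `z^m` by binary powering, structural in the fuel (first argument). -/
def zpowAux (S : ℕ) (Z : MC) : ℕ → ℕ → MC
  | 0, _ => MC.ofInt S 1
  | fuel + 1, m =>
    if m = 0 then MC.ofInt S 1
    else
      let q := zpowAux S Z fuel (m / 2)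
      if m % 2 = 0 then MC.mul S q q else MC.mul S (MC.mul S q q) Z

/-- `zpow S Z m ∋ z^m` for `Z ∋ z` (fuel `m` suffices). -/
def zpow (S : ℕ) (Z : MC) (m : ℕ) : MC := zpowAux S Z m m

/-- Invariant of `zpowAux`: with fuel `≥ m` it encloses `z^m`. -/
theorem mem_zpowAux (hS : 0 < S) {z : ℂ} {Z : MC} (hz : MC.mem S z Z) :
    ∀ fuel m : ℕ, m ≤ fuel → MC.mem S (z ^ m) (zpowAux S Z fuel m)
  | 0, m, hm => by
    have : m = 0 := by omega
    subst this
    simpa [zpowAux] using MC.mem_ofInt S 1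
  | fuel + 1, m, hm => by
    unfold zpowAux
    split_ifs with h0 h2
    · subst h0; simpa using MC.mem_ofInt S 1
    · have hq := mem_zpowAux hS hz fuel (m / 2) (by omega)
      have e : z ^ m = z ^ (m / 2) * z ^ (m / 2) := by
        rw [← pow_add]; congr 1; omega
      rw [e]; exact MC.mem_mul hS hq hq
    · have hq := mem_zpowAux hS hz fuel (m / 2) (by omega)
      have e : z ^ m = z ^ (m / 2) * z ^ (m / 2) * z := by
        rw [← pow_add, ← pow_succ]; congr 1; omega
      rw [e]; exact MC.mem_mul hS (MC.mem_mul hS hq hq) hz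

/-- **`zpow ∋ z^m`.** -/
theorem mem_zpow (hS : 0 < S) {z : ℂ} {Z : MC} (hz : MC.mem S z Z) (m : ℕ) :
    MC.mem S (z ^ m) (zpow S Z m) :=
  mem_zpowAux hS hz m m le_rfl

/-! ## The tag boxes at a mode -/

/-- `C`-tag box at mode `m`: `Σ_{j < |Ws|} Ws[j]·Re(Zs[j]^m)`. -/
def trigTagC (S : ℕ) (Ws : List MI) (Zs : List MC) (m : ℕ) : MI :=
  sumBox S (fun j ↦ MI.mul S (Ws.getD j ⟨0, 0⟩) (zpow S (Zs.getD j default) m).re) Ws.length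

/-- `S`-tag box at mode `m`: `Σ_{j < |Ws|} Ws[j]·Im(Zs[j]^m)`. -/
def trigTagS (S : ℕ) (Ws : List MI) (Zs : List MC) (m : ℕ) : MI :=
  sumBox S (fun j ↦ MI.mul S (Ws.getD j ⟨0, 0⟩) (zpow S (Zs.getD j default) m).im) Ws.length

/-- **`trigTagC ∋ Σ_j w_j cos(mφ_j)`**: weights `Ws[j] ∋ w_j` and phases `Zs[j] ∋ e^{iφ_j}` for `j < J = |Ws|`. -/
theorem mem_trigTagC (hS : 0 < S) {J : ℕ} {w φ : ℕ → ℝ} {Ws : List MI} {Zs : List MC} (hWl : Ws.length = J)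
    (hw : ∀ j < J, MI.mem S (w j) (Ws.getD j ⟨0, 0⟩))
    (hZ : ∀ j < J, MC.mem S (Complex.exp (I * φ j)) (Zs.getD j default)) (m : ℕ) :
    MI.mem S (∑ j ∈ Finset.range J, w j * Real.cos ((m : ℝ) * φ j)) (trigTagC S Ws Zs m) := by
  unfold trigTagC
  rw [hWl]
  refine mem_sumBox J fun j hj ↦ ?_
  have h := (mem_zpow hS (hZ j hj) m).1
  rw [(cexp_I_mul_pow_re_im (φ j) m).1] at h
  exact MI.mem_mul hS (hw j hj) h

/-- **`trigTagS ∋ Σ_j w_j sin(mφ_j)`** (same hypotheses). -/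
theorem mem_trigTagS (hS : 0 < S) {J : ℕ} {w φ : ℕ → ℝ} {Ws : List MI} {Zs : List MC} (hWl : Ws.length = J)
    (hw : ∀ j < J, MI.mem S (w j) (Ws.getD j ⟨0, 0⟩))
    (hZ : ∀ j < J, MC.mem S (Complex.exp (I * φ j)) (Zs.getD j default)) (m : ℕ) :
    MI.mem S (∑ j ∈ Finset.range J, w j * Real.sin ((m : ℝ) * φ j)) (trigTagS S Ws Zs m) := by
  unfold trigTagS
  rw [hWl]
  refine mem_sumBox J fun j hj ↦ ?_
  have h := (mem_zpow hS (hZ j hj) m).2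
  rw [(cexp_I_mul_pow_re_im (φ j) m).2] at h
  exact MI.mem_mul hS (hw j hj) h

/-- How the generator feeds `hZ`: `MC.expI` encloses `e^{θ i}`, and `e^{iφ} = e^{φ i}`. -/
theorem cexp_I_mul_eq (φ : ℝ) : Complex.exp (I * φ) = Complex.exp ((φ : ℂ) * I) := by
  rw [mul_comm]

/-! ## The smooth tags: `log m` (and `1`) -/

/-- `log`-tag box at mode `m` (`MI.logNat` with `K` series terms; junk if the guard below fails). -/
def logTag (S K : ℕ) (m : ℕ) : MI := (MI.logNat S K m).getD ⟨0, 0⟩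

/-- Decidable guard: every `MI.logNat S K (m₀+i)`, `i < n`, succeeds. -/
def logTagsOK (S K m₀ n : ℕ) : Bool := (List.range n).all fun i ↦ (MI.logNat S K (m₀ + i)).isSome

/-- **`logTag ∋ log(m₀+i)`** for `i < n` under the guard (the `hA/hB` input of `mem_rangeEntryBox` for the `log` tag). -/
theorem mem_logTag (hS : 0 < S) {K m₀ n : ℕ} (h : logTagsOK S K m₀ n = true) :
    ∀ i < n, MI.mem S (Real.log (((m₀ + i : ℕ)) : ℝ)) (logTag S K (m₀ + i)) := by
  intro i hi
  unfold logTagsOK at h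
  rw [List.all_eq_true] at h
  have hi' := h i (List.mem_range.2 hi)
  obtain ⟨L, hL⟩ := Option.isSome_iff_exists.1 hi'
  unfold logTag
  rw [hL, Option.getD_some]
  exact MI.mem_logNat hS hL

/-- The constant tag `1` at every mode. -/
theorem mem_oneTag (S m : ℕ) : MI.mem S ((fun _ : ℕ ↦ (1 : ℝ)) m) (WinConst.ratBox S 1) := by
  simpa using WinConst.mem_ratBox S 1

end CinfCoeff

end Summit.RiemannHypothesis.RiemannHypothesis.Theorems.WeilFormatC
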